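import Mathlib
import Summits.MatrixMultiplication.MatrixMultiplication.Theses.LevelGradedCohnUmans
import Literature.NumberTheory.DiophantineGeometry.PartitionTableauxProofs
import Literature.RepresentationTheory.FiniteGroups.VershikKerovMaxDegreeProofs
import Literature.RepresentationTheory.FiniteGroups.VershikKerovLimitShape

/-!
# `SnLevelDesigns` (stmt-MatrixMultiplication-7613), line `garnir-annihilator`: S5g `stub_hookGlue` — Vershik–Kerov ε-glue from the first-row hook bounds

Crux `Summit.MatrixMultiplication.MatrixMultiplication.Theses.LevelGradedCohnUmans.SnLevelDesigns`; skeleton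
`Cruxes/SnLevelDesigns/Lines/garnir-annihilator.lean` (lead reshape, 7 registered stubs); this file proves the registered stub
`stub_hookGlue` verbatim (name + signature, tree-only vocabulary) and lands `--supports stmt-MatrixMultiplication-7613`.

`FirstRowHooks → EpsilonGlue` (both spelled out). Given the peeling bounds (hypothesis) and a family of level-`k`
triples with property `P`, `n ≥ k³`, `D_k(n)^{3/2} ≤ k^C |X||Y||Z|` for arbitrarily large `k`: for every `ε > 0`
some member satisfies `Σ_{μ₁≥n-k}(f^μ)^{2+ε} < (|X||Y||Z|)^{(2+ε)/3}`. Proof (polynomial form of the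
Vershik–Kerov decay, no `exp` in the transfer):
* `hg_decay`: for every `A`, for `k` large, `n ≥ k³` and `μ₁ ≥ n - k`: `(f^μ)² · k^A ≤ D_k(n)`. With
  `j := n - μ₁ ≤ k`: `f^μ ≤ C(n,j) D(j)` (hypothesis 1), `D_k(n) ≥ e^{-2} C(n,k)² k!` (hypothesis 2),
  `C(n,j) k^{k-j} ≤ C(n,k)` (`hg_choose_mul_pow_le`, `n ≥ k² + k - 1`); for `2j ≤ k` everything is in `ℕ`
  (`D(j)² ≤ j! ≤ k!`, `8k^A ≤ k^{2(k-j)}`, `hg_core_small`); for `k < 2j` Vershik–Kerov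
  (`VershikKerov1985_maxCharDegree_holds` at `ε := c₂/2`) gives `D(j)² ≤ j! e^{-c₂√j}` and
  `e^{c₂√j} ≥ (c₂√j)^{2A+2}/(2A+2)! ≥ 8(2j)^A ≥ 8k^A` (`hg_core_large`); `e² < 8`.
* `hg_budget_le`: `Σ_{level}(f^μ)^{2+ε} ≤ M^{ε/2} D_k(n)` whenever `(f^μ)² ≤ M` on the level window.
* transfer: with `A` such that `C(2+ε)/3 < Aε/2` and `M := D/k^A`,
  `budget ≤ D^{1+ε/2}/k^{Aε/2} < D^{1+ε/2}/k^{C(2+ε)/3} = (D^{3/2}/k^C)^{(2+ε)/3} ≤ V^{(2+ε)/3}` (`D > 0`).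
-/

set_option linter.dupNamespace false

namespace Summit.MatrixMultiplication.MatrixMultiplication.Theorems.SnLevelDesigns

open scoped BigOperators

open Literature.NumberTheory.DiophantineGeometry (numStandardTableaux numStandardTableaux_pos_holds)
open Literature.RepresentationTheory.FiniteGroups (maxCharDegree maxCharDegree_sq_le_factorial
  VershikKerov1985_maxCharDegree_holds vkUpperConst vkUpperConst_pos)

/-- Binomial ratio bound: `C(n,j) · k^{k-j} ≤ C(n,k)` for `j ≤ k` once `k² + k ≤ n + 1`
(iterate `C(n,j)·k ≤ C(n,j+1)`, from `C(n,j+1)(j+1) = C(n,j)(n-j)` and `n - j ≥ k²`). -/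
theorem hg_choose_mul_pow_le (n k : ℕ) (hn : k * k + k ≤ n + 1) :
    ∀ d j : ℕ, j + d = k → n.choose j * k ^ d ≤ n.choose k := by
  intro d
  induction d with
  | zero =>
    intro j hj
    rw [Nat.add_zero] at hj
    rw [hj, pow_zero, mul_one]
  | succ d ih =>
    intro j hj
    have hk : 0 < k := by omega
    have hstep : n.choose j * k ≤ n.choose (j + 1) := by
      have h1 : n.choose (j + 1) * (j + 1) = n.choose j * (n - j) := Nat.choose_succ_right_eq n j
      have h2 : k * k ≤ n - j := by omega
      refine le_of_mul_le_mul_right ?_ hk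
      calc n.choose j * k * k = n.choose j * (k * k) := by ring
        _ ≤ n.choose j * (n - j) := Nat.mul_le_mul_left _ h2
        _ = n.choose (j + 1) * (j + 1) := h1.symm
        _ ≤ n.choose (j + 1) * k := Nat.mul_le_mul_left _ (by omega)
    calc n.choose j * k ^ (d + 1) = n.choose j * k * k ^ d := by ring
      _ ≤ n.choose (j + 1) * k ^ d := Nat.mul_le_mul_right _ hstep
      _ ≤ n.choose k := ih (j + 1) (by omega)

/-- Regime `2j ≤ k` of the decay estimate, entirely in `ℕ`:
`8 · C(n,j)² · D(j)² · k^A ≤ C(n,k)² · k!` (`D(j)² ≤ j! ≤ k!`, `8k^A ≤ k^{A+1} ≤ k^{2(k-j)}`). -/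
theorem hg_core_small (n k j A : ℕ) (h2j : 2 * j ≤ k) (hA : A + 1 ≤ k) (h8 : 8 ≤ k)
    (hn : k * k + k ≤ n + 1) :
    8 * n.choose j ^ 2 * maxCharDegree (Equiv.Perm (Fin j)) ^ 2 * k ^ A ≤
      n.choose k ^ 2 * k.factorial := by
  have hc := hg_choose_mul_pow_le n k hn (k - j) j (by omega)
  have hc2 : n.choose j ^ 2 * (k ^ (k - j)) ^ 2 ≤ n.choose k ^ 2 := by
    rw [← mul_pow]
    exact Nat.pow_le_pow_left hc 2
  have hD : maxCharDegree (Equiv.Perm (Fin j)) ^ 2 ≤ k.factorial :=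
    (maxCharDegree_sq_le_factorial j).trans (Nat.factorial_le (by omega))
  have h8' : 8 * k ^ A ≤ (k ^ (k - j)) ^ 2 :=
    calc 8 * k ^ A ≤ k * k ^ A := Nat.mul_le_mul_right _ h8
      _ = k ^ (A + 1) := by ring
      _ ≤ k ^ ((k - j) * 2) := Nat.pow_le_pow_right (by omega) (by omega)
      _ = (k ^ (k - j)) ^ 2 := pow_mul k (k - j) 2
  calc 8 * n.choose j ^ 2 * maxCharDegree (Equiv.Perm (Fin j)) ^ 2 * k ^ A
      = n.choose j ^ 2 * maxCharDegree (Equiv.Perm (Fin j)) ^ 2 * (8 * k ^ A) := by ring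
    _ ≤ n.choose j ^ 2 * k.factorial * (k ^ (k - j)) ^ 2 := by gcongr
    _ = n.choose j ^ 2 * (k ^ (k - j)) ^ 2 * k.factorial := by ring
    _ ≤ n.choose k ^ 2 * k.factorial := Nat.mul_le_mul_right _ hc2

/-- Regime `k < 2j` of the decay estimate (Vershik–Kerov): there is `k₂` such that for
`k ≥ k₂` and `j ≤ k < 2j`, `8 · D(j)² · k^A ≤ k!`. Indeed `D(j)² ≤ j! · e^{-c₂√j}`
(`VershikKerov1985_maxCharDegree_holds` at `ε := c₂/2`, squared) and
`e^{c₂√j} ≥ (c₂√j)^{2A+2}/(2A+2)! ≥ 8 (2j)^A ≥ 8 k^A` for `j` large. -/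
theorem hg_core_large (A : ℕ) : ∃ k₂ : ℕ, ∀ k : ℕ, k₂ ≤ k → ∀ j : ℕ, j ≤ k → k < 2 * j →
    8 * (maxCharDegree (Equiv.Perm (Fin j)) : ℝ) ^ 2 * (k : ℝ) ^ A ≤ (k.factorial : ℝ) := by
  obtain ⟨n₀, hn₀⟩ :=
    VershikKerov1985_maxCharDegree_holds (vkUpperConst / 2) (half_pos vkUpperConst_pos)
  have hc : 0 < vkUpperConst := vkUpperConst_pos
  set K : ℝ := 8 * 2 ^ A * ((2 * A + 2).factorial : ℝ) / vkUpperConst ^ (2 * A + 2) with hK_def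
  refine ⟨2 * n₀ + 2 * ⌈K⌉₊, fun k hk j hjk hkj => ?_⟩
  have hjn₀ : n₀ ≤ j := by omega
  have hjK : K ≤ j := (Nat.le_ceil K).trans (by exact_mod_cast (show ⌈K⌉₊ ≤ j by omega))
  have hj0 : (0 : ℝ) ≤ j := Nat.cast_nonneg _
  -- Vershik–Kerov, squared
  have hDg : (maxCharDegree (Equiv.Perm (Fin j)) : ℝ) ^ 2 ≤
      (j.factorial : ℝ) * Real.exp (-(vkUpperConst * Real.sqrt j)) := by
    have h0 : (0 : ℝ) ≤ maxCharDegree (Equiv.Perm (Fin j)) := Nat.cast_nonneg _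
    calc (maxCharDegree (Equiv.Perm (Fin j)) : ℝ) ^ 2
        ≤ (Real.sqrt (j.factorial : ℝ) *
            Real.exp (-((vkUpperConst - vkUpperConst / 2) * Real.sqrt (j : ℝ)))) ^ 2 :=
          pow_le_pow_left₀ h0 (hn₀ j hjn₀).2 2
      _ = (j.factorial : ℝ) * Real.exp (-(vkUpperConst * Real.sqrt j)) := by
          rw [mul_pow, Real.sq_sqrt (Nat.cast_nonneg _), ← Real.exp_nat_mul]
          congr 2
          push_cast
          ring
  -- the exponential beats the polynomial
  have hexp : 8 * (2 * (j : ℝ)) ^ A ≤ Real.exp (vkUpperConst * Real.sqrt j) := by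
    have hx : 0 ≤ vkUpperConst * Real.sqrt j := mul_nonneg hc.le (Real.sqrt_nonneg _)
    have h := Real.pow_div_factorial_le_exp _ hx (2 * A + 2)
    have hsq : (vkUpperConst * Real.sqrt j) ^ (2 * A + 2) =
        vkUpperConst ^ (2 * A + 2) * (j : ℝ) ^ (A + 1) := by
      rw [mul_pow]
      congr 1
      rw [show 2 * A + 2 = 2 * (A + 1) by ring, pow_mul, Real.sq_sqrt hj0]
    have hK' : 8 * 2 ^ A * ((2 * A + 2).factorial : ℝ) ≤ j * vkUpperConst ^ (2 * A + 2) := by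
      have h' := hjK
      rwa [hK_def, div_le_iff₀ (pow_pos hc _)] at h'
    have hfne : ((2 * A + 2).factorial : ℝ) ≠ 0 := by positivity
    calc 8 * (2 * (j : ℝ)) ^ A
        = 8 * 2 ^ A * ((2 * A + 2).factorial : ℝ) * (j : ℝ) ^ A / ((2 * A + 2).factorial : ℝ) := by
          rw [eq_div_iff hfne, mul_pow]
          ring
      _ ≤ (j : ℝ) * vkUpperConst ^ (2 * A + 2) * (j : ℝ) ^ A / ((2 * A + 2).factorial : ℝ) := by
          gcongr
      _ = (vkUpperConst * Real.sqrt j) ^ (2 * A + 2) / ((2 * A + 2).factorial : ℝ) := by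
          rw [hsq]
          ring
      _ ≤ Real.exp (vkUpperConst * Real.sqrt j) := h
  have hkA : (k : ℝ) ^ A ≤ (2 * (j : ℝ)) ^ A :=
    pow_le_pow_left₀ (Nat.cast_nonneg _) (by exact_mod_cast hkj.le) A
  have hfac : (j.factorial : ℝ) ≤ k.factorial := by exact_mod_cast Nat.factorial_le hjk
  have hE : Real.exp (-(vkUpperConst * Real.sqrt j)) * Real.exp (vkUpperConst * Real.sqrt j) = 1 := by
    rw [← Real.exp_add, neg_add_cancel, Real.exp_zero]
  calc 8 * (maxCharDegree (Equiv.Perm (Fin j)) : ℝ) ^ 2 * (k : ℝ) ^ A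
      ≤ 8 * ((j.factorial : ℝ) * Real.exp (-(vkUpperConst * Real.sqrt j))) * (2 * (j : ℝ)) ^ A := by
        gcongr
    _ = (j.factorial : ℝ) * Real.exp (-(vkUpperConst * Real.sqrt j)) * (8 * (2 * (j : ℝ)) ^ A) := by
        ring
    _ ≤ (j.factorial : ℝ) * Real.exp (-(vkUpperConst * Real.sqrt j)) *
          Real.exp (vkUpperConst * Real.sqrt j) := by
        gcongr
    _ = j.factorial := by rw [mul_assoc, hE, mul_one]
    _ ≤ k.factorial := hfac

/-- Both regimes: there is `k₁` such that for `k ≥ k₁`, `k² + k ≤ n + 1` and `j ≤ k`,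
`8 · C(n,j)² · D(j)² · k^A ≤ C(n,k)² · k!`. -/
theorem hg_core (A : ℕ) : ∃ k₁ : ℕ, ∀ k : ℕ, k₁ ≤ k → ∀ n : ℕ, k * k + k ≤ n + 1 → ∀ j : ℕ, j ≤ k →
    8 * (n.choose j : ℝ) ^ 2 * (maxCharDegree (Equiv.Perm (Fin j)) : ℝ) ^ 2 * (k : ℝ) ^ A ≤
      (n.choose k : ℝ) ^ 2 * (k.factorial : ℝ) := by
  obtain ⟨k₂, hk₂⟩ := hg_core_large A
  refine ⟨k₂ + A + 8, fun k hk n hn j hjk => ?_⟩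
  rcases Nat.lt_or_ge k (2 * j) with hlt | hge
  · have hcj : (n.choose j : ℝ) ≤ n.choose k := by
      have h := hg_choose_mul_pow_le n k hn (k - j) j (by omega)
      exact_mod_cast le_trans (Nat.le_mul_of_pos_right _ (Nat.pow_pos (by omega))) h
    have h := hk₂ k (by omega) j hjk hlt
    calc 8 * (n.choose j : ℝ) ^ 2 * (maxCharDegree (Equiv.Perm (Fin j)) : ℝ) ^ 2 * (k : ℝ) ^ A
        = (n.choose j : ℝ) ^ 2 *
            (8 * (maxCharDegree (Equiv.Perm (Fin j)) : ℝ) ^ 2 * (k : ℝ) ^ A) := by ring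
      _ ≤ (n.choose k : ℝ) ^ 2 * (k.factorial : ℝ) := by gcongr
  · exact_mod_cast hg_core_small n k j A hge (by omega) (by omega) hn

/-- Arithmetic of the regime `n ≥ k³`, `k ≥ 2`: `3k ≤ n` and `k² + k ≤ n + 1`. -/
theorem hg_arith {k n : ℕ} (hk : 2 ≤ k) (hn : k ^ 3 ≤ n) : 3 * k ≤ n ∧ k * k + k ≤ n + 1 := by
  have hkk : 3 ≤ k * k := by nlinarith
  have h1 : 3 * k ≤ k ^ 3 :=
    calc 3 * k ≤ k * k * k := Nat.mul_le_mul_right k hkk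
      _ = k ^ 3 := by ring
  have h2 : k * k + k ≤ k ^ 3 :=
    calc k * k + k ≤ k * k + k * k := Nat.add_le_add_left (Nat.le_mul_of_pos_left k (by omega)) _
      _ = 2 * (k * k) := by ring
      _ ≤ k * (k * k) := Nat.mul_le_mul_right _ hk
      _ = k ^ 3 := by ring
  omega

/-- **Decay lemma** (super-polynomial smallness of the level-`k` degrees against the level
dimension): from the first-row hook bounds, for every `A` there is `k₁` such that for `k ≥ k₁`,
`n ≥ k³` and every `μ ⊢ n` with `μ₁ ≥ n - k`, `(f^μ)² · k^A ≤ D_k(n)`. -/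
theorem hg_decay
    (h1 : ∀ (n : ℕ) (μ : Nat.Partition n),
      numStandardTableaux μ ≤ n.choose (n - μ.parts.sup) *
        maxCharDegree (Equiv.Perm (Fin (n - μ.parts.sup))))
    (h2 : ∀ (n k : ℕ), 3 * k ≤ n →
      Real.exp (-2) * ((n.choose k : ℝ) ^ 2 * (k.factorial : ℝ)) ≤
        ((∑ μ : Nat.Partition n, if n - k ≤ μ.parts.sup then
            numStandardTableaux μ ^ 2 else 0 : ℕ) : ℝ))
    (A : ℕ) :
    ∃ k₁ : ℕ, ∀ k : ℕ, k₁ ≤ k → ∀ n : ℕ, k ^ 3 ≤ n → ∀ μ : Nat.Partition n,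
      n - k ≤ μ.parts.sup →
        (numStandardTableaux μ : ℝ) ^ 2 * (k : ℝ) ^ A ≤
          ((∑ ν : Nat.Partition n, if n - k ≤ ν.parts.sup then
              numStandardTableaux ν ^ 2 else 0 : ℕ) : ℝ) := by
  obtain ⟨k₁, hk₁⟩ := hg_core A
  refine ⟨k₁ + 2, fun k hk n hn μ hμ => ?_⟩
  obtain ⟨h3k, hkk⟩ := hg_arith (show 2 ≤ k by omega) hn
  have hcore := hk₁ k (by omega) n hkk (n - μ.parts.sup) (by omega)
  have hf : (numStandardTableaux μ : ℝ) ≤ (n.choose (n - μ.parts.sup) : ℝ) *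
      (maxCharDegree (Equiv.Perm (Fin (n - μ.parts.sup))) : ℝ) := by
    exact_mod_cast h1 n μ
  have hf2 : (numStandardTableaux μ : ℝ) ^ 2 ≤ (n.choose (n - μ.parts.sup) : ℝ) ^ 2 *
      (maxCharDegree (Equiv.Perm (Fin (n - μ.parts.sup))) : ℝ) ^ 2 := by
    rw [← mul_pow]
    exact pow_le_pow_left₀ (Nat.cast_nonneg _) hf 2
  have hD := h2 n k h3k
  have he : Real.exp 2 < 8 := by
    have h9 := Real.exp_one_lt_d9
    have h0 := Real.exp_pos (1 : ℝ)
    rw [show (2 : ℝ) = 1 + 1 by norm_num, Real.exp_add]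
    nlinarith
  have he2 : Real.exp 2 * Real.exp (-2) = 1 := by
    rw [← Real.exp_add]
    norm_num
  have hCD : (n.choose k : ℝ) ^ 2 * (k.factorial : ℝ) ≤ Real.exp 2 *
      ((∑ ν : Nat.Partition n, if n - k ≤ ν.parts.sup then
          numStandardTableaux ν ^ 2 else 0 : ℕ) : ℝ) :=
    calc (n.choose k : ℝ) ^ 2 * (k.factorial : ℝ)
        = Real.exp 2 * (Real.exp (-2) * ((n.choose k : ℝ) ^ 2 * (k.factorial : ℝ))) := by
          rw [← mul_assoc, he2, one_mul]
      _ ≤ _ := mul_le_mul_of_nonneg_left hD (Real.exp_pos 2).le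
  have hDnn : (0 : ℝ) ≤ ((∑ ν : Nat.Partition n, if n - k ≤ ν.parts.sup then
      numStandardTableaux ν ^ 2 else 0 : ℕ) : ℝ) := Nat.cast_nonneg _
  calc (numStandardTableaux μ : ℝ) ^ 2 * (k : ℝ) ^ A
      ≤ (n.choose (n - μ.parts.sup) : ℝ) ^ 2 *
          (maxCharDegree (Equiv.Perm (Fin (n - μ.parts.sup))) : ℝ) ^ 2 * (k : ℝ) ^ A := by
        gcongr
    _ ≤ (n.choose k : ℝ) ^ 2 * (k.factorial : ℝ) / 8 := by
        rw [le_div_iff₀ (by norm_num)]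
        linarith [hcore]
    _ ≤ Real.exp 2 * ((∑ ν : Nat.Partition n, if n - k ≤ ν.parts.sup then
          numStandardTableaux ν ^ 2 else 0 : ℕ) : ℝ) / 8 := by
        gcongr
    _ ≤ _ := by
        rw [div_le_iff₀ (by norm_num)]
        nlinarith [he, hDnn]

/-- **Budget factorisation**: if `(f^μ)² ≤ M` on the level window `μ₁ ≥ n - k`, then
`Σ_{μ₁ ≥ n-k} (f^μ)^{2+ε} ≤ M^{ε/2} · D_k(n)` (`(f^μ)^{2+ε} = (f^μ)² · ((f^μ)²)^{ε/2}`). -/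
theorem hg_budget_le (n k : ℕ) {ε M : ℝ} (hε : 0 ≤ ε)
    (hle : ∀ μ : Nat.Partition n, n - k ≤ μ.parts.sup → (numStandardTableaux μ : ℝ) ^ 2 ≤ M) :
    (∑ μ : Nat.Partition n, if n - k ≤ μ.parts.sup then
        (numStandardTableaux μ : ℝ) ^ (2 + ε) else 0) ≤
      M ^ (ε / 2) * ((∑ μ : Nat.Partition n, if n - k ≤ μ.parts.sup then
        numStandardTableaux μ ^ 2 else 0 : ℕ) : ℝ) := by
  push_cast
  rw [Finset.mul_sum]
  refine Finset.sum_le_sum fun μ _ => ?_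
  split_ifs with hμ
  · have hf : (0 : ℝ) < numStandardTableaux μ := by exact_mod_cast numStandardTableaux_pos_holds μ
    have h2 : ((numStandardTableaux μ : ℝ) ^ 2) ^ (ε / 2) = (numStandardTableaux μ : ℝ) ^ ε := by
      rw [← Real.rpow_two, ← Real.rpow_mul hf.le]
      congr 1
      ring
    rw [Real.rpow_add hf, Real.rpow_two, ← h2, mul_comm]
    exact mul_le_mul_of_nonneg_right (Real.rpow_le_rpow (by positivity) (hle μ hμ) (by linarith))
      (by positivity)
  · rw [mul_zero]

/-- **`stub_hookGlue`** (registered stub of crux stmt-MatrixMultiplication-7613, line `garnir-annihilator`).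
`FirstRowHooks → EpsilonGlue` (both spelled out): from the first-row hook bounds (hypothesis) and a family of
level-`k` triples with `n ≥ k³`, `D_k(n)^{3/2} ≤ k^C · |X||Y||Z|` for arbitrarily large `k`, every `ε > 0` has a member
with `Σ_{μ₁ ≥ n-k} (f^μ)^{2+ε} < (|X||Y||Z|)^{(2+ε)/3}` (`hg_decay` + `hg_budget_le` + `rpow` bookkeeping). -/
theorem stub_hookGlue :
    ((∀ (n : ℕ) (μ : Nat.Partition n),
        Literature.NumberTheory.DiophantineGeometry.numStandardTableaux μ ≤ n.choose (n - μ.parts.sup) *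
          Literature.RepresentationTheory.FiniteGroups.maxCharDegree (Equiv.Perm (Fin (n - μ.parts.sup)))) ∧
      (∀ (n k : ℕ), 3 * k ≤ n →
        Real.exp (-2) * ((n.choose k : ℝ) ^ 2 * (k.factorial : ℝ)) ≤
          ((∑ μ : Nat.Partition n, if n - k ≤ μ.parts.sup then
              Literature.NumberTheory.DiophantineGeometry.numStandardTableaux μ ^ 2 else 0 : ℕ) : ℝ))) →
      ∀ P : (n : ℕ) → ℕ → Finset (Equiv.Perm (Fin n)) → Finset (Equiv.Perm (Fin n)) →
          Finset (Equiv.Perm (Fin n)) → Prop,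
        (∃ C : ℕ, ∀ k₀ : ℕ, ∃ k : ℕ, k₀ ≤ k ∧ ∃ (n : ℕ) (X Y Z : Finset (Equiv.Perm (Fin n))),
            k ^ 3 ≤ n ∧ P n k X Y Z ∧
              ((∑ μ : Nat.Partition n, if n - k ≤ μ.parts.sup then
                  Literature.NumberTheory.DiophantineGeometry.numStandardTableaux μ ^ 2 else 0 : ℕ) : ℝ) ^ ((3 : ℝ) / 2) ≤
                (k : ℝ) ^ C * ((X.card * Y.card * Z.card : ℕ) : ℝ)) →
        ∀ ε : ℝ, 0 < ε → ∃ (n k : ℕ) (X Y Z : Finset (Equiv.Perm (Fin n))), P n k X Y Z ∧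
          (∑ μ : Nat.Partition n, if n - k ≤ μ.parts.sup then
              (Literature.NumberTheory.DiophantineGeometry.numStandardTableaux μ : ℝ) ^ (2 + ε) else 0) <
            ((X.card * Y.card * Z.card : ℕ) : ℝ) ^ ((2 + ε) / 3) := by
  rintro ⟨h1, h2⟩ P ⟨C, hfam⟩ ε hε
  -- an exponent `A` with `C(2+ε)/3 < Aε/2`
  obtain ⟨A, hA⟩ := exists_nat_gt (2 * C * (2 + ε) / (3 * ε))
  have hexp : (C : ℝ) * (2 + ε) / 3 < A * (ε / 2) := by
    rw [div_lt_iff₀ (by positivity)] at hA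
    rw [div_lt_iff₀ (by norm_num)]
    linarith
  obtain ⟨k₁, hk₁⟩ := hg_decay h1 h2 A
  obtain ⟨k, hk, n, X, Y, Z, hn, hP, hV⟩ := hfam (k₁ + 2)
  refine ⟨n, k, X, Y, Z, hP, ?_⟩
  set D : ℕ := ∑ μ : Nat.Partition n, if n - k ≤ μ.parts.sup then numStandardTableaux μ ^ 2 else 0
    with hD
  have hk1 : (1 : ℝ) < k := by exact_mod_cast (show 1 < k by omega)
  have hk0 : (0 : ℝ) < k := by linarith
  have hkA : (0 : ℝ) < (k : ℝ) ^ A := pow_pos hk0 A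
  obtain ⟨h3k, -⟩ := hg_arith (show 2 ≤ k by omega) hn
  have hDpos : (0 : ℝ) < D := by
    have hlow := h2 n k h3k
    have hc : (0 : ℝ) < n.choose k := by exact_mod_cast Nat.choose_pos (by omega)
    have : (0 : ℝ) < Real.exp (-2) * ((n.choose k : ℝ) ^ 2 * (k.factorial : ℝ)) := by positivity
    linarith
  -- the budget is at most `(D/k^A)^{ε/2} · D`
  have hbud := hg_budget_le n k (M := (D : ℝ) / (k : ℝ) ^ A) hε.le
    (fun μ hμ => by
      rw [le_div_iff₀ hkA]
      exact hk₁ k (by omega) n hn μ hμ)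
  refine lt_of_le_of_lt hbud ?_
  calc ((D : ℝ) / (k : ℝ) ^ A) ^ (ε / 2) * (D : ℝ)
      = (D : ℝ) ^ (1 + ε / 2) / (k : ℝ) ^ ((A : ℝ) * (ε / 2)) := by
        rw [Real.div_rpow hDpos.le hkA.le, ← Real.rpow_natCast (k : ℝ) A, ← Real.rpow_mul hk0.le,
          Real.rpow_add hDpos, Real.rpow_one]
        ring
    _ < (D : ℝ) ^ (1 + ε / 2) / (k : ℝ) ^ ((C : ℝ) * (2 + ε) / 3) :=
        div_lt_div_of_pos_left (Real.rpow_pos_of_pos hDpos _) (Real.rpow_pos_of_pos hk0 _)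
          (Real.rpow_lt_rpow_of_exponent_lt hk1 hexp)
    _ = ((D : ℝ) ^ ((3 : ℝ) / 2) / (k : ℝ) ^ C) ^ ((2 + ε) / 3) := by
        rw [Real.div_rpow (Real.rpow_nonneg hDpos.le _) (pow_nonneg hk0.le _),
          ← Real.rpow_mul hDpos.le, ← Real.rpow_natCast (k : ℝ) C, ← Real.rpow_mul hk0.le,
          show (3 : ℝ) / 2 * ((2 + ε) / 3) = 1 + ε / 2 by ring,
          show (C : ℝ) * ((2 + ε) / 3) = C * (2 + ε) / 3 by ring]
    _ ≤ ((X.card * Y.card * Z.card : ℕ) : ℝ) ^ ((2 + ε) / 3) := by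
        refine Real.rpow_le_rpow (by positivity) ?_ (by positivity)
        rw [div_le_iff₀' (pow_pos hk0 C)]
        exact hV

end Summit.MatrixMultiplication.MatrixMultiplication.Theorems.SnLevelDesigns
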